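import Literature.NumberTheory.Transcendental.RoySmallValueEstimatesEndgameAssemblyProofs
import HarnessLib

/-!
# Route `RoyCriterion`, crux `NguyenRoySmallValueTranslates` (stmt-Schanuel-1051), line `Sketch`
# — stub `stub_case2Free`

Registered stub C of the skeleton of line `Sketch` for the crux
`Summit.Schanuel.Schanuel.Theses.RoyCriterion.NguyenRoySmallValueTranslates`, over an abstract
`NguyenRoy.EndgameData σ β ν` (the data entering §6 of Nguyen–Roy 2016): Case 2 of §6 WITHOUT
its degree hypothesis `deg Z̃_D > 2A₁₄ (D*)^{σ−1}`. With `d = D*`, `X = D^{ν−2}`, `c = deg Z̃_D`,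
`h = h(Z̃_D)` the output is the raw inequality `(κ/16) d^σ X c ≤ d h` of the printed argument
(its non-negative height term dropped) together with `d^{σ−1} ≤ (8/κ) D^{1+β−ν}`.

Proof: the tree's `EndgameData.case2_core` verbatim (`Z = τ^{T*−1}(Z̃_D) ⊄ W_{D*}` gives the
polynomial of `notIn`; sub-case (i) — some value `≤ 2e^{−(D*)^ν/2}` — is absurd for `D*` large;
sub-case (ii) — Proposition 17 at level `T*` — yields the two inequalities), with part (I) of its
conclusion read off one step earlier.

## References

* [NguyenRoy2016] N. A. V. Nguyen, D. Roy, IJNT 12 (2016) 1273–1293 = arXiv:1412.5163, §6,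
  Case 2; Proposition 17.
-/

-- `Summit.Schanuel.Schanuel.…` is the mandated layout of this single-problem summit (CONVENTIONS §1).
set_option linter.dupNamespace false

noncomputable section

open Filter Finset
open scoped Classical

namespace Summit.Schanuel.Schanuel.Theorems.NguyenRoySharp

open Literature.NumberTheory.Transcendental
open Literature.NumberTheory.Transcendental.NguyenRoy

section Abstract

variable {σ β ν : ℝ} (E : EndgameData σ β ν)

/-- **Case 2 of §6 with a free degree lower bound** (one level `D`, `d = D*` large, NO hypothesis
`deg(Z̃_D) > 2A₁₄ (D*)^{σ−1}`): the raw inequality `(κ/16) d^σ D^{ν−2} deg Z̃_D ≤ d · h(Z̃_D)` and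
`d^{σ−1} ≤ (8/κ) D^{1+β−ν}`. Proof as printed: `Z = τ^{T*−1}(Z̃_D) ⊄ W_{D*}` gives the polynomial
`P = Φʲ(P̃_{D*})` (`notIn`), whose values at the points of `Z` are bounded below in the mean
([R2012] Prop. 2.3) and above pointwise ((6.5)); the sub-case where some value is
`≤ 2e^{−(D*)^ν/2}` is absurd for `D*` large, and otherwise Proposition 17 at level `T*` yields
the two inequalities (the first one BEFORE the degree hypothesis of Case 2 is inserted).
[cite: NguyenRoy2016, §6, Case 2] -/
theorem stub_case2Free (hσ1 : 1 ≤ σ) (hβ : σ + 1 < β) (hν : 2 + β - σ < ν)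
    {D d : ℕ} {Zt : E.V} (hd1 : 1 ≤ d) (hdD : d < D) (hd0 : E.D₀ ≤ d)
    (hN₂ : ∀ deg h : ℝ, 0 ≤ deg → deg ≤ 2 * E.A₁₄ * (d : ℝ) ^ (2 - σ) → 0 ≤ h →
      h ≤ 2 * E.B₁₄ * (d : ℝ) ^ (1 + β - σ) →
      Real.log 2 + deg * (Real.log 3 + 3 * (d : ℝ) ^ β + E.c₇ * d + E.c₄ * (d : ℝ) ^ (1 + σ)) +
        d * h < (d : ℝ) ^ ν / 2)
    (hN₃ : Real.log 2 + 3 * (d : ℝ) ^ β + E.c₇ * d + E.c₄ * (d : ℝ) ^ (1 + σ) ≤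
      E.κ / 16 * (d : ℝ) ^ (σ + ν - 2))
    (hN₄ : ((d : ℝ) + 2) ^ 3 * Real.exp (2 * (d : ℝ) ^ β) * Real.exp (E.c₁ * (d : ℝ) ^ σ)
      ≤ Real.exp (3 * (d : ℝ) ^ β))
    (hcrit : E.A₁₄ * (d : ℝ) ^ (2 - σ) < (E.pts Zt).card ∨
      E.B₁₄ * (d : ℝ) ^ (1 + β - σ) < E.ht Zt)
    (hdeg : ((E.pts Zt).card : ℝ) ≤ 2 * E.A₁₄ * (d : ℝ) ^ (2 - σ))
    (hht : E.ht Zt ≤ 2 * E.B₁₄ * (d : ℝ) ^ (1 + β - σ))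
    (hP17 : ∀ n : ℕ, 1 ≤ n → n ≤ ⌊(D : ℝ) ^ σ⌋₊ →
      ∃ ι : E.Pt → ℤ, (∀ b ∈ E.pts Zt, |ι b| < n) ∧
        ∑ b ∈ E.pts Zt, Real.log (E.dist b (E.γ (ι b))) ≤
          -(n * (E.κ / 4) * (D : ℝ) ^ (ν - β - 2) * ((D : ℝ) ^ β * (E.pts Zt).card + D * E.ht Zt))) :
    E.κ / 16 * (d : ℝ) ^ σ * (D : ℝ) ^ (ν - 2) * (E.pts Zt).card ≤ d * E.ht Zt ∧
      (d : ℝ) ^ (σ - 1) ≤ 8 / E.κ * (D : ℝ) ^ (1 + β - ν) := by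
  -- adapted from Literature/NumberTheory/Transcendental/
  --   RoySmallValueEstimatesEndgameAssemblyProofs.lean, `EndgameData.case2_core`
  classical
  have hκ := E.κ_pos
  have hdpos : (0 : ℝ) < d := by exact_mod_cast hd1
  have hdr : (1 : ℝ) ≤ d := by exact_mod_cast hd1
  have hdD' : (d : ℝ) ≤ D := by exact_mod_cast hdD.le
  have hDpos : (0 : ℝ) < D := by linarith
  have hcard1 : (1 : ℝ) ≤ (E.pts Zt).card := E.one_le_card _
  set c : ℝ := ((E.pts Zt).card : ℝ) with hc_def
  set T : ℕ := ⌊(d : ℝ) ^ σ⌋₊ with hT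
  have h1σ : (1 : ℝ) ≤ (d : ℝ) ^ σ := Real.one_le_rpow hdr (by linarith)
  have h1T : 1 ≤ T := Nat.le_floor (by exact_mod_cast h1σ)
  have hTσ : (T : ℝ) ≤ (d : ℝ) ^ σ := Nat.floor_le (by positivity)
  have hT2 : (d : ℝ) ^ σ / 2 ≤ T := by
    have i1 := Nat.lt_floor_add_one ((d : ℝ) ^ σ)
    have i2 : (1 : ℝ) ≤ T := by exact_mod_cast h1T
    rw [← hT] at i1
    linarith
  have hTD : T ≤ ⌊(D : ℝ) ^ σ⌋₊ :=
    Nat.floor_mono (Real.rpow_le_rpow hdpos.le hdD' (by linarith))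
  have hT1r : (0 : ℝ) ≤ (T : ℝ) - 1 := by
    have : (1 : ℝ) ≤ T := by exact_mod_cast h1T
    linarith
  have habsT : |(((T : ℤ) - 1 : ℤ) : ℝ)| = (T : ℝ) - 1 := by
    push_cast; exact abs_of_nonneg hT1r
  -- `Z := τ^{T-1} Z̃_D ⊄ W_d`
  have hnot : ¬ E.IsIn (E.τV ((T : ℤ) - 1) Zt) d := by
    refine E.not_isIn_of_crit hd0 hcrit ?_
    rw [habsT]
    have : (0 : ℝ) ≤ T := by positivity
    linarith
  obtain ⟨j, hj0, hj2, v, hvpos, hL, hU⟩ := E.notIn d hd0 _ hnot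
  obtain ⟨ι, hι, hS⟩ := hP17 T h1T hTD
  have hcardZ : (E.pts (E.τV ((T : ℤ) - 1) Zt)).card = (E.pts Zt).card := E.card_pts_τV _ _
  have hhtZ : E.ht (E.τV ((T : ℤ) - 1) Zt) ≤ E.ht Zt + E.c₄ * (d : ℝ) ^ σ * c := by
    have h := E.ht_τV_le ((T : ℤ) - 1) Zt
    rw [habsT] at h
    have : E.c₄ * ((T : ℝ) - 1) * c ≤ E.c₄ * (d : ℝ) ^ σ * c := by
      apply mul_le_mul_of_nonneg_right _ (by positivity)
      exact mul_le_mul_of_nonneg_left (by linarith) E.c₄_nonneg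
    linarith
  rw [hcardZ, E.sum_pts_τV] at hL
  -- pointwise upper bound (6.5) ⇒ (6.6)
  have hvpos' : ∀ b ∈ E.pts Zt, 0 < v (E.τ ((T : ℤ) - 1) b) := fun b hb =>
    hvpos _ (E.τ_mem_pts_τV _ _ hb)
  have hU' : ∀ b ∈ E.pts Zt, v (E.τ ((T : ℤ) - 1) b) ≤
      Real.exp (-(d : ℝ) ^ ν / 2) + Real.exp (3 * (d : ℝ) ^ β) * E.dist b (E.γ (ι b)) := by
    intro b hb
    have hbZ : E.τ ((T : ℤ) - 1) b ∈ E.pts (E.τV ((T : ℤ) - 1) Zt) := E.τ_mem_pts_τV _ _ hb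
    have hιb := abs_lt.mp (hι b hb)
    have hk0 : 0 ≤ j + (ι b + ((T : ℤ) - 1)) := by omega
    have hk4 : j + (ι b + ((T : ℤ) - 1)) < 4 * (T : ℕ) := by omega
    have hu := hU _ hbZ (ι b + ((T : ℤ) - 1)) hk0 hk4
    have hγ : E.γ (ι b + ((T : ℤ) - 1)) = E.τ ((T : ℤ) - 1) (E.γ (ι b)) := by
      rw [E.τ_γ]; ring_nf
    have hdist : E.dist (E.τ ((T : ℤ) - 1) b) (E.γ (ι b + ((T : ℤ) - 1))) ≤
        Real.exp (E.c₁ * (d : ℝ) ^ σ) * E.dist b (E.γ (ι b)) := by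
      rw [hγ]
      refine le_trans (E.dist_τ_le _ _ _) (mul_le_mul_of_nonneg_right ?_ (E.dist_nonneg _ _))
      apply Real.exp_le_exp.mpr
      rw [habsT]
      exact mul_le_mul_of_nonneg_left (by linarith) E.c₁_nonneg
    have hnn : (0 : ℝ) ≤ ((d : ℝ) + 2) ^ 3 * Real.exp (2 * (d : ℝ) ^ β) := by positivity
    calc v (E.τ ((T : ℤ) - 1) b)
        ≤ Real.exp (-(d : ℝ) ^ ν / 2) + ((d : ℝ) + 2) ^ 3 * Real.exp (2 * (d : ℝ) ^ β) *
            E.dist (E.τ ((T : ℤ) - 1) b) (E.γ (ι b + ((T : ℤ) - 1))) := hu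
      _ ≤ Real.exp (-(d : ℝ) ^ ν / 2) + ((d : ℝ) + 2) ^ 3 * Real.exp (2 * (d : ℝ) ^ β) *
            (Real.exp (E.c₁ * (d : ℝ) ^ σ) * E.dist b (E.γ (ι b))) := by
          gcongr
      _ = Real.exp (-(d : ℝ) ^ ν / 2) + (((d : ℝ) + 2) ^ 3 * Real.exp (2 * (d : ℝ) ^ β) *
            Real.exp (E.c₁ * (d : ℝ) ^ σ)) * E.dist b (E.γ (ι b)) := by ring
      _ ≤ Real.exp (-(d : ℝ) ^ ν / 2) + Real.exp (3 * (d : ℝ) ^ β) * E.dist b (E.γ (ι b)) := by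
          gcongr
          exact E.dist_nonneg _ _
  set G : ℝ := Real.exp (3 * (d : ℝ) ^ β) with hG
  set e₀ : ℝ := Real.exp (-(d : ℝ) ^ ν / 2) with he₀
  have hGpos : 0 < G := Real.exp_pos _
  have he₀pos : 0 < e₀ := Real.exp_pos _
  have hG1 : 1 ≤ G := by
    rw [hG]; apply Real.one_le_exp; positivity
  have he₀1 : e₀ ≤ 1 := by
    rw [he₀]; apply Real.exp_le_one_iff.mpr
    have : 0 ≤ (d : ℝ) ^ ν := by positivity
    linarith
  have hlog2 : (0 : ℝ) ≤ Real.log 2 := Real.log_nonneg (by norm_num)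
  have hlog3 : (0 : ℝ) ≤ Real.log 3 := Real.log_nonneg (by norm_num)
  have hβpos : (0 : ℝ) ≤ (d : ℝ) ^ β := by positivity
  have hd1σ : (d : ℝ) * (d : ℝ) ^ σ = (d : ℝ) ^ (1 + σ) := by
    rw [Real.rpow_add hdpos, Real.rpow_one]
  by_cases hsub : ∃ b ∈ E.pts Zt, G * E.dist b (E.γ (ι b)) ≤ e₀
  · -- sub-case (i): absurd for `d` large
    exfalso
    obtain ⟨b₀, hb₀, hsmall⟩ := hsub
    have hv0 : Real.log (v (E.τ ((T : ℤ) - 1) b₀)) ≤ Real.log 2 + -(d : ℝ) ^ ν / 2 := by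
      have h := hU' b₀ hb₀
      have h2 : v (E.τ ((T : ℤ) - 1) b₀) ≤ 2 * e₀ := by linarith
      calc Real.log (v (E.τ ((T : ℤ) - 1) b₀)) ≤ Real.log (2 * e₀) :=
            Real.log_le_log (hvpos' _ hb₀) h2
        _ = Real.log 2 + -(d : ℝ) ^ ν / 2 := by
            rw [Real.log_mul two_ne_zero he₀pos.ne', he₀, Real.log_exp]
    have hvall : ∀ b ∈ E.pts Zt, Real.log (v (E.τ ((T : ℤ) - 1) b)) ≤
        Real.log 3 + 3 * (d : ℝ) ^ β := by
      intro b hb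
      have h := hU' b hb
      have hdb : E.dist b (E.γ (ι b)) ≤ 2 := E.dist_le_two _ _
      have h3 : v (E.τ ((T : ℤ) - 1) b) ≤ 3 * G := by
        have : G * E.dist b (E.γ (ι b)) ≤ G * 2 := mul_le_mul_of_nonneg_left hdb hGpos.le
        linarith
      calc Real.log (v (E.τ ((T : ℤ) - 1) b)) ≤ Real.log (3 * G) :=
            Real.log_le_log (hvpos' _ hb) h3
        _ = Real.log 3 + 3 * (d : ℝ) ^ β := by
            rw [Real.log_mul three_ne_zero hGpos.ne', hG, Real.log_exp]
    have hsum : ∑ b ∈ E.pts Zt, Real.log (v (E.τ ((T : ℤ) - 1) b)) ≤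
        Real.log 2 - (d : ℝ) ^ ν / 2 + c * (Real.log 3 + 3 * (d : ℝ) ^ β) := by
      rw [← Finset.add_sum_erase _ _ hb₀]
      have h1 : ∑ b ∈ (E.pts Zt).erase b₀, Real.log (v (E.τ ((T : ℤ) - 1) b)) ≤
          ∑ _b ∈ (E.pts Zt).erase b₀, (Real.log 3 + 3 * (d : ℝ) ^ β) :=
        Finset.sum_le_sum fun b hb => hvall b (Finset.mem_of_mem_erase hb)
      rw [Finset.sum_const, nsmul_eq_mul] at h1
      have h2 : ((((E.pts Zt).erase b₀).card : ℕ) : ℝ) ≤ c := by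
        rw [hc_def]; exact_mod_cast Finset.card_erase_le
      have h3 : (0 : ℝ) ≤ Real.log 3 + 3 * (d : ℝ) ^ β := by positivity
      have h4 := mul_le_mul_of_nonneg_right h2 h3
      linarith [hv0, h1, h4]
    have hfin := hN₂ c (E.ht Zt) (by positivity) hdeg (E.ht_nonneg _) hht
    -- `hL : -(c₇ d c + d ht Z) ≤ ∑`, `hhtZ`, `hsum` contradict `hfin`
    have h5 : (d : ℝ) * E.ht (E.τV ((T : ℤ) - 1) Zt) ≤
        d * E.ht Zt + E.c₄ * (d : ℝ) ^ (1 + σ) * c := by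
      have := mul_le_mul_of_nonneg_left hhtZ hdpos.le
      rw [← hd1σ]
      linarith [this, show (d : ℝ) * (E.ht Zt + E.c₄ * (d : ℝ) ^ σ * c) =
        d * E.ht Zt + E.c₄ * (d * (d : ℝ) ^ σ) * c by ring]
    have h6 : c * (Real.log 3 + 3 * (d : ℝ) ^ β + E.c₇ * d + E.c₄ * (d : ℝ) ^ (1 + σ)) =
        c * (Real.log 3 + 3 * (d : ℝ) ^ β) + E.c₇ * d * c + E.c₄ * (d : ℝ) ^ (1 + σ) * c := by ring
    linarith [hL, hsum, h5, h6, hfin]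
  · -- sub-case (ii)
    push Not at hsub
    have hvall : ∀ b ∈ E.pts Zt, Real.log (v (E.τ ((T : ℤ) - 1) b)) ≤
        Real.log 2 + 3 * (d : ℝ) ^ β + Real.log (E.dist b (E.γ (ι b))) := by
      intro b hb
      have h := hU' b hb
      have hs := hsub b hb
      have hdbpos : 0 < E.dist b (E.γ (ι b)) := E.dist_γ_pos Zt b hb _
      have h2 : v (E.τ ((T : ℤ) - 1) b) ≤ 2 * (G * E.dist b (E.γ (ι b))) := by linarith
      calc Real.log (v (E.τ ((T : ℤ) - 1) b)) ≤ Real.log (2 * (G * E.dist b (E.γ (ι b)))) :=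
            Real.log_le_log (hvpos' _ hb) h2
        _ = Real.log 2 + 3 * (d : ℝ) ^ β + Real.log (E.dist b (E.γ (ι b))) := by
            rw [Real.log_mul two_ne_zero (mul_pos hGpos hdbpos).ne',
              Real.log_mul hGpos.ne' hdbpos.ne', hG, Real.log_exp]
            ring
    have hsum : ∑ b ∈ E.pts Zt, Real.log (v (E.τ ((T : ℤ) - 1) b)) ≤
        c * (Real.log 2 + 3 * (d : ℝ) ^ β) + ∑ b ∈ E.pts Zt, Real.log (E.dist b (E.γ (ι b))) := by
      calc ∑ b ∈ E.pts Zt, Real.log (v (E.τ ((T : ℤ) - 1) b))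
          ≤ ∑ b ∈ E.pts Zt, (Real.log 2 + 3 * (d : ℝ) ^ β + Real.log (E.dist b (E.γ (ι b)))) :=
            Finset.sum_le_sum hvall
        _ = c * (Real.log 2 + 3 * (d : ℝ) ^ β) +
            ∑ b ∈ E.pts Zt, Real.log (E.dist b (E.γ (ι b))) := by
            rw [Finset.sum_add_distrib, Finset.sum_const, nsmul_eq_mul]
    -- notation for the powers of `D`
    have hPQ : (D : ℝ) ^ (ν - β - 2) * (D : ℝ) ^ β = (D : ℝ) ^ (ν - 2) := by
      rw [← Real.rpow_add hDpos]; ring_nf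
    have hPD : (D : ℝ) ^ (ν - β - 2) * D = (D : ℝ) ^ (ν - β - 1) := by
      rw [mul_comm]
      nth_rewrite 1 [← Real.rpow_one (D : ℝ)]
      rw [← Real.rpow_add hDpos]; ring_nf
    set X : ℝ := (D : ℝ) ^ (ν - 2)
    set Y : ℝ := (D : ℝ) ^ (ν - β - 1) with hY
    have hXpos : 0 < X := Real.rpow_pos_of_pos hDpos _
    have hYpos : 0 < Y := Real.rpow_pos_of_pos hDpos _
    have hS' : ∑ b ∈ E.pts Zt, Real.log (E.dist b (E.γ (ι b))) ≤
        -(T * (E.κ / 4) * X * c) - T * (E.κ / 4) * Y * E.ht Zt := by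
      have e : (T : ℝ) * (E.κ / 4) * (D : ℝ) ^ (ν - β - 2) * ((D : ℝ) ^ β * c + D * E.ht Zt) =
          T * (E.κ / 4) * X * c + T * (E.κ / 4) * Y * E.ht Zt := by
        rw [← hPQ, ← hPD]; ring
      rw [e] at hS
      linarith
    -- (1): `T(κ/4) X c + T(κ/4) Y h ≤ c R + d h`
    set h : ℝ := E.ht Zt
    have hh0 : 0 ≤ h := E.ht_nonneg _
    set R : ℝ := Real.log 2 + 3 * (d : ℝ) ^ β + E.c₇ * d + E.c₄ * (d : ℝ) ^ (1 + σ) with hR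
    have h1 : (T : ℝ) * (E.κ / 4) * X * c + T * (E.κ / 4) * Y * h ≤ c * R + d * h := by
      have h5 : (d : ℝ) * E.ht (E.τV ((T : ℤ) - 1) Zt) ≤ d * h + E.c₄ * (d : ℝ) ^ (1 + σ) * c := by
        have := mul_le_mul_of_nonneg_left hhtZ hdpos.le
        rw [← hd1σ]
        linarith [this, show (d : ℝ) * (h + E.c₄ * (d : ℝ) ^ σ * c) =
          d * h + E.c₄ * (d * (d : ℝ) ^ σ) * c by ring]
      have h6 : c * R = c * (Real.log 2 + 3 * (d : ℝ) ^ β) + E.c₇ * d * c +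
          E.c₄ * (d : ℝ) ^ (1 + σ) * c := by rw [hR]; ring
      linarith [hL, hsum, hS', h5, h6]
    -- (2): replace `T` by `d^σ / 2`
    have hdσ : 0 < (d : ℝ) ^ σ := by positivity
    have hTκ : E.κ / 8 * (d : ℝ) ^ σ ≤ T * (E.κ / 4) := by
      have := mul_le_mul_of_nonneg_left hT2 (by positivity : (0 : ℝ) ≤ E.κ / 4)
      linarith
    have h2 : E.κ / 8 * (d : ℝ) ^ σ * X * c + E.κ / 8 * (d : ℝ) ^ σ * Y * h ≤ c * R + d * h := by
      have i1 : E.κ / 8 * (d : ℝ) ^ σ * X * c ≤ T * (E.κ / 4) * X * c :=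
        mul_le_mul_of_nonneg_right (mul_le_mul_of_nonneg_right hTκ hXpos.le) (by positivity)
      have i2 : E.κ / 8 * (d : ℝ) ^ σ * Y * h ≤ T * (E.κ / 4) * Y * h :=
        mul_le_mul_of_nonneg_right (mul_le_mul_of_nonneg_right hTκ hYpos.le) hh0
      linarith
    -- (★): `R ≤ (κ/16) d^σ X`
    have hR' : R ≤ E.κ / 16 * (d : ℝ) ^ σ * X := by
      have e : (d : ℝ) ^ (σ + ν - 2) = (d : ℝ) ^ σ * (d : ℝ) ^ (ν - 2) := by
        rw [← Real.rpow_add hdpos]; ring_nf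
      have hx : (d : ℝ) ^ (ν - 2) ≤ X := Real.rpow_le_rpow hdpos.le hdD' (by linarith)
      calc R ≤ E.κ / 16 * (d : ℝ) ^ (σ + ν - 2) := hN₃
        _ = E.κ / 16 * (d : ℝ) ^ σ * (d : ℝ) ^ (ν - 2) := by rw [e]; ring
        _ ≤ E.κ / 16 * (d : ℝ) ^ σ * X :=
            mul_le_mul_of_nonneg_left hx (by positivity)
    have hstar : E.κ / 16 * (d : ℝ) ^ σ * X * c + E.κ / 8 * (d : ℝ) ^ σ * Y * h ≤ d * h := by
      have := mul_le_mul_of_nonneg_left hR' (by positivity : (0 : ℝ) ≤ c)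
      linarith
    -- `h > 0`
    have hterm1 : 0 < E.κ / 16 * (d : ℝ) ^ σ * X * c := by positivity
    have hterm2 : 0 ≤ E.κ / 8 * (d : ℝ) ^ σ * Y * h := by positivity
    have hhpos : 0 < h := by
      by_contra hcon
      have : h = 0 := le_antisymm (not_lt.mp hcon) hh0
      rw [this] at hstar
      linarith
    constructor
    · -- (I), raw form: `(κ/16) d^σ X c ≤ d h`
      linarith [hstar, hterm2]
    · -- (II): `d^{σ-1} ≤ (8/κ) D^{1+β-ν}`
      have i1 : E.κ / 8 * (d : ℝ) ^ σ * Y * h ≤ d * h := by linarith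
      have i2 : E.κ / 8 * (d : ℝ) ^ σ * Y ≤ d := le_of_mul_le_mul_right (by linarith) hhpos
      have e1 : (d : ℝ) ^ σ = (d : ℝ) ^ (σ - 1) * d := by
        nth_rewrite 3 [← Real.rpow_one (d : ℝ)]
        rw [← Real.rpow_add hdpos]; ring_nf
      have e2 : Y * (D : ℝ) ^ (1 + β - ν) = 1 := by
        rw [hY, ← Real.rpow_add hDpos, show ν - β - 1 + (1 + β - ν) = 0 by ring, Real.rpow_zero]
      have hZpos : 0 < (D : ℝ) ^ (1 + β - ν) := Real.rpow_pos_of_pos hDpos _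
      -- from `i2`: `(κ/8) d^{σ-1} Y ≤ 1`
      have i3 : E.κ / 8 * (d : ℝ) ^ (σ - 1) * Y ≤ 1 := by
        rw [e1] at i2
        have : (E.κ / 8 * (d : ℝ) ^ (σ - 1) * Y) * d ≤ 1 * d := by
          linarith [i2, show E.κ / 8 * ((d : ℝ) ^ (σ - 1) * d) * Y =
            E.κ / 8 * (d : ℝ) ^ (σ - 1) * Y * d by ring]
        exact le_of_mul_le_mul_right this hdpos
      have i4 := mul_le_mul_of_nonneg_right i3 hZpos.le
      rw [one_mul, mul_assoc, e2, mul_one] at i4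
      -- `i4 : κ/8 * d^{σ-1} ≤ D^{1+β-ν}`
      rw [div_mul_eq_mul_div, div_le_iff₀ (by norm_num : (0 : ℝ) < 8)] at i4
      rw [div_mul_eq_mul_div, le_div_iff₀ hκ]
      linarith

end Abstract

end Summit.Schanuel.Schanuel.Theorems.NguyenRoySharp

end
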